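/-
Copyright (c) 2026 the pub-hodgecm-mathlib formalisation cell (harness21).  Prover seat hodgecm-mathlib-K2Liu-p26 (g3), Track B «K2-LIT»,
#184♮ = hLiu418 = `stmt-HodgeConjecture-24832`; socket #41 KIND W, brick (3a′) «CARRIER CONSTANT UNIFORM IN `T`» (KW desk F0P2-p08 (g4) ruling
(KW-R5), 2026-09-05T01:18:48Z).  THEOREMS ONLY (no `def`, no `instance`, no notation, no named-fact hypothesis, no `sorry`); helper lane
`--supports stmt-HodgeConjecture-24832`.
-/
import Summits.HodgeConjecture.HodgeConjecture.Theorems.K2LiuSiegelUnipotentHaarPinned      -- ★ Φ3b: topology ∕ Borel tower of `N_Δ`, DEFS leaf 3 `unipDeltaSplitAt`, Lit restricted-product measures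
import Literature.MeasureTheory.RestrictedProduct.QuotientMeasureNormalized                  -- ★ `rpMeasure_setOf_forall_mem_eq_prod`, `measurableSet_setOf_forall_mem`
import HarnessLib

/-!
# Crux `HLiu418`, socket #41, KIND W, brick (3a′) — `K2LiuKindWArchCarrierUniform`:
# THE ARCHIMEDEAN CARRIER MEASURE `νinf T` OF THE PINNED SPLITTING DOES NOT DEPEND ON `T`

Cell `hodgecm-mathlib`, crux item hLiu418 = `stmt-HodgeConjecture-24832` (helper lane `--supports … --as helper`, count-neutral), route of record
`HCCMUnconditional`; squad K2 ∕ K2Liu, road `K2_Liu`, socket #41, KIND W block; KW desk F0P2-p08 (g4) ruling (KW-R5) placement (3a′);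
consumer = (3c) (the S–M bookkeeping of the archimedean kind-W letters, K2E3-p11 (g10) ∕ KW desk).

WHAT.  ★ `K2LiuKindWBlockOfRecordCMOfLocalLettersHaar.kindW_block_cm_of_localLetters_haar` (p863724) exports, for a measure `νN` on `N_Δ(𝔸)`,
local measures `ν_v` on the `N_Δ(L⁺_v)` with `ν_v(K_{H,v} ∩ N_Δ(L⁺_v)) = 1` at EVERY finite place `v` (clause `hνK`), and a FAMILY of archimedean
carriers `νinf T` (one for each finite set of places `T`), the factorisations (clause `hmap`)
`(unipDeltaSplitAt T)_* νN = νinf T ⊗ ((⊗_{v∈T} ν_v) ⊗ ∏'_{v∉T}(ν_v ; K_{H,v} ∩ N_Δ(L⁺_v)))` for every `T`.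
THIS FILE: **`νinf T = νinf T'` for all `T, T'`** — the archimedean carrier, hence every archimedean constant computed against it, is
uniform in `T`.

PROOF (no Haar uniqueness, no regularity; `νN` and `νinf T` need not be Haar measures).  Fix `T` and a measurable `A ⊆ N_Δ(L⁺ ⊗ ℝ)` and
evaluate `hmap T` on the box `A ×ˢ ((∏_{v∈T} K_v) ×ˢ {y | ∀ v ∉ T, y_v ∈ K_v})`, `K_v := K_{H,v} ∩ N_Δ(L⁺_v)`:
* its finite factors have mass one — `(⊗_{v∈T} ν_v)(∏_{v∈T} K_v) = ∏_{v∈T} ν_v(K_v) = 1` (`Measure.pi_pi`, `hνK`) and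
  `∏'_{v∉T}(ν_v ; K_v){y | ∀ v, y_v ∈ K_v} = ∏_{v∈∅} … = 1` (★ Tate's box formula `rpMeasure_setOf_forall_mem_eq_prod` at `S₀ = S = ∅`), so the
  right-hand side is `νinf T (A)` (`Measure.prod_prod` twice);
* the left-hand side is `νN` of the preimage of the box under `unipDeltaSplitAt T`, and that preimage is
  `C_A = {u | (u_∞ ∈ A) ∧ ∀ v, u_v ∈ K_v}` — INDEPENDENT OF `T`, because `unipDeltaSplitAt T u = (u_∞, ((u_v)_{v∈T}, (u_v)_{v∉T}))` reads all its
  coordinates off the one point `unipDeltaSplit u` (★ `unipDeltaSplitAt_apply`, ★ `fstS_apply`, ★ `sndS_apply`, all `rfl`).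
Hence `νinf T (A) = νN(C_A) = νinf T' (A)` for every measurable `A`, i.e. `νinf T = νinf T'` (`Measure.ext`).

CONTENTS (namespace `…Cruxes.HLiu418.K2LiuKindWArchCarrierUniform`, generic frame `{N M n} (e : Fin N × Fin M ≃ Fin n)` as ★ Φ3b; p863724's
`Fin 2 × Fin 1 ≃ Fin n` is an instance of it).
* §1 `preimage_unipDeltaSplitAt_box` — the preimage of the box `A ×ˢ ((∏_{v∈T} K_v) ×ˢ {y | ∀ v ∉ T, y_v ∈ K_v})` under `unipDeltaSplitAt T` is the `T`-free
  set `{u | (unipDeltaSplit u).1 ∈ A ∧ ∀ v, (unipDeltaSplit u).2 v ∈ K_v}` (definitional unfolding only).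
* §2 `νinf_apply_eq_measure_setOf` — ONE `T`: `νinf T (A) = νN {u | (unipDeltaSplit u).1 ∈ A ∧ ∀ v, (unipDeltaSplit u).2 v ∈ K_v}` for measurable `A`.
* §3 **`νinf_eq_of_factorisation`** — the head: `∀ T T', νinf T = νinf T'`, hypotheses = the p863724 exported clauses `hνσ` (σ-finiteness of the
  `ν_v`), `hνK` (:84–85) and `hmap` (:86–89) VERBATIM and nothing else.
[cite: CasselsFrohlichANT1967, Ch. XV (Tate) §3.3] [cite: BorelJacquet1979, §4.1] [cite: Tan1999, §2]

HONEST LABEL.  Count-neutral helper; it retires nothing by itself: `HC_CM` is proved only modulo the 7 printed citations (2 remaining named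
inputs: hLiu418 = `stmt-HodgeConjecture-24832`, h413 = `stmt-HodgeConjecture-24833`) until rung 0 closes.

## References
* [CasselsFrohlichANT1967] J. W. S. Cassels, A. Fröhlich (eds.), *Algebraic Number Theory* (1967), Ch. XV (Tate) §3.3 (restricted product measures,
  the box formula).
* [BorelJacquet1979] A. Borel, H. Jacquet, *Automorphic forms and automorphic representations*, PSPM 33.1 (1979), §4.1.
* [Tan1999] V. Tan, *Poles of Siegel Eisenstein series on U(n,n)*, Canad. J. Math. 51 (1999), §2.
-/

set_option autoImplicit false
-- the mandated namespace repeats the single-problem summit's segment (`HodgeConjecture.HodgeConjecture`)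
set_option linter.dupNamespace false

noncomputable section

open scoped Matrix RestrictedProduct ENNReal NNReal
open NumberField IsDedekindDomain MeasureTheory Measure Filter

namespace Summit.HodgeConjecture.HodgeConjecture.Cruxes.HLiu418.K2LiuKindWArchCarrierUniform

open Literature.NumberTheory.Automorphic Literature.NumberTheory.GaloisRepresentations
open Literature.NumberTheory.GelbartRogawski1991 Literature.NumberTheory.GelbartRogawski1991.GRConstruction
open Literature.NumberTheory.K2Lit.SiegelDoubled
open Literature.NumberTheory.K2Lit.PlaceSplitting
open Literature.MeasureTheory.RestrictedProduct
open Literature.Topology.Algebra.RestrictedProduct (inH isOpen_inH)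
open Summit.HodgeConjecture.HodgeConjecture.Cruxes.HLiu418.K2LiuAdelicPlaceSplittingFubini
open Summit.HodgeConjecture.HodgeConjecture.Cruxes.HLiu418.K2LiuSiegelUnipotentLocalDefs
open Summit.HodgeConjecture.HodgeConjecture.Cruxes.HLiu418.K2LiuSiegelUnipotentSplitDefs
open Summit.HodgeConjecture.HodgeConjecture.Cruxes.HLiu418.K2LiuSiegelUnipotentSplitAtDefs
open Summit.HodgeConjecture.HodgeConjecture.Cruxes.HLiu418.K2LiuSiegelUnipotentHaarPinned

variable (L : Type) [Field L] [NumberField L] [IsCMField L]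
variable {N M n : ℕ} (e : Fin N × Fin M ≃ Fin n)
  (dV : Fin N → L) (hdV : ∀ i, IsCMField.complexConj L (dV i) = dV i)
  (dW : Fin M → L) (hdW : ∀ i, IsCMField.complexConj L (dW i) = dW i)

variable [DecidableEq (HeightOneSpectrum (𝓞 (Fp L)))]

/-! ## §1 The preimage of a box under `unipDeltaSplitAt T` does not depend on `T` -/

set_option maxHeartbeats 800000 in -- MEASURED (fails at 400000, passes at 800000): `simp only` rewriting under the binders of the nested-subtype restricted product (motive type-checking = `isDefEq`∕`whnf` of the coercion tower of `unipDeltaSplitAt T`); `ext`∕`simp only`∕`exact`, no search tactics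
/-- **The preimage of a box under the splitting at `T` is `T`-free.**  For `A ⊆ N_Δ(L⁺ ⊗ ℝ)` and `K_v := K_{H,v} ∩ N_Δ(L⁺_v)`,
`(unipDeltaSplitAt T)⁻¹ (A ×ˢ ((∏_{v∈T} K_v) ×ˢ {y | ∀ v ∉ T, y_v ∈ K_v})) = {u | (unipDeltaSplit u).1 ∈ A ∧ ∀ v, (unipDeltaSplit u).2 v ∈ K_v}` — all coordinates of
`unipDeltaSplitAt T u = (u_∞, ((u_v)_{v∈T}, (u_v)_{v∉T}))` are read off the one point `unipDeltaSplit u` (★ `unipDeltaSplitAt_apply`, ★ `fstS_apply`, ★ `sndS_apply`,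
all definitional, used as `simp only` rules); the only step is the case split `v ∈ T ∨ v ∉ T`. [cite: BorelJacquet1979, §4.1] [cite: Tan1999, §2] -/
theorem preimage_unipDeltaSplitAt_box (T : Finset (HeightOneSpectrum (𝓞 (Fp L)))) (A : Set ↥(unipDeltaArch L e dV hdV dW hdW)) :
    (unipDeltaSplitAt L e dV hdV dW hdW T) ⁻¹' (A ×ˢ ((Set.univ.pi fun v : T => ((inH (fun v => UnitaryGroup.localInt L (IsCMField.complexConj L) (n + n) (hermD L e dV hdV dW hdW) v) (fun v => unipDeltaLoc L e dV hdV dW hdW v) v.1 : Subgroup ↥(unipDeltaLoc L e dV hdV dW hdW v.1)) : Set ↥(unipDeltaLoc L e dV hdV dW hdW v.1))) ×ˢ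
      {y : Πʳ v : {v : HeightOneSpectrum (𝓞 (Fp L)) // v ∉ T}, [↥(unipDeltaLoc L e dV hdV dW hdW v.1), inH (fun v => UnitaryGroup.localInt L (IsCMField.complexConj L) (n + n) (hermD L e dV hdV dW hdW) v) (fun v => unipDeltaLoc L e dV hdV dW hdW v) v.1] | ∀ j : {v : HeightOneSpectrum (𝓞 (Fp L)) // v ∉ T}, y j ∈ ((inH (fun v => UnitaryGroup.localInt L (IsCMField.complexConj L) (n + n) (hermD L e dV hdV dW hdW) v) (fun v => unipDeltaLoc L e dV hdV dW hdW v) j.1 : Subgroup ↥(unipDeltaLoc L e dV hdV dW hdW j.1)) : Set ↥(unipDeltaLoc L e dV hdV dW hdW j.1))})) =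
    {u : ↥(unipDelta L e dV hdV dW hdW) | (unipDeltaSplit L e dV hdV dW hdW u).1 ∈ A ∧
      ∀ v : HeightOneSpectrum (𝓞 (Fp L)), (unipDeltaSplit L e dV hdV dW hdW u).2 v ∈ (inH (fun v => UnitaryGroup.localInt L (IsCMField.complexConj L) (n + n) (hermD L e dV hdV dW hdW) v) (fun v => unipDeltaLoc L e dV hdV dW hdW v) v : Subgroup ↥(unipDeltaLoc L e dV hdV dW hdW v))} := by
  ext u
  simp only [Set.mem_preimage, Set.mem_prod, Set.mem_univ_pi, Set.mem_setOf_eq, SetLike.mem_coe, unipDeltaSplitAt_apply, fstS_apply, sndS_apply]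
  refine and_congr_right fun _ => ⟨fun h v => ?_, fun h => ⟨fun i => h i.1, fun j => h j.1⟩⟩
  by_cases hv : v ∈ T
  · exact h.1 ⟨v, hv⟩
  · exact h.2 ⟨v, hv⟩

section Measures

variable [∀ v : HeightOneSpectrum (𝓞 (Fp L)), MeasurableSpace ↥(unipDeltaLoc L e dV hdV dW hdW v)] [∀ v : HeightOneSpectrum (𝓞 (Fp L)), BorelSpace ↥(unipDeltaLoc L e dV hdV dW hdW v)]
  [MeasurableSpace ↥(unipDelta L e dV hdV dW hdW)] [BorelSpace ↥(unipDelta L e dV hdV dW hdW)]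
  [MeasurableSpace ↥(unipDeltaArch L e dV hdV dW hdW)] [BorelSpace ↥(unipDeltaArch L e dV hdV dW hdW)]

/-! ## §2 One `T`: the archimedean carrier evaluated on a measurable set -/

set_option maxHeartbeats 800000 in -- MEASURED (fails at 400000, passes at 800000; ★ Φ3b §3 needs 1600000 on the same tower): `whnf` of the Borel instance tower on `N_∞ × ((Π_{v∈T} N_v) × Πʳ_{v∉T} N_v)` of nested subtypes; plain `have`∕`rw`∕`calc`, no search tactics
/-- **The archimedean carrier evaluated on a measurable set.**  If `(unipDeltaSplitAt T)_* νN = νinfT ⊗ ((⊗_{v∈T} ν_v) ⊗ ∏'_{v∉T}(ν_v ; K_v))` with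
`ν_v(K_v) = 1` for all `v` (`K_v := K_{H,v} ∩ N_Δ(L⁺_v)`), then for every measurable `A ⊆ N_Δ(L⁺ ⊗ ℝ)`
`νinfT (A) = νN {u | u_∞ ∈ A ∧ ∀ v, u_v ∈ K_v}` — the right-hand side does not mention `T`.  Box evaluation: `Measure.pi_pi` + `hνK`, Tate's box
formula ★ `rpMeasure_setOf_forall_mem_eq_prod` (at `S₀ = S = ∅`), `Measure.prod_prod`, `Measure.map_apply` (measurability of the continuous splitting under
the Borel tower of ★ Φ3b §3), and §1. [cite: CasselsFrohlichANT1967, Ch. XV (Tate) §3.3] [cite: BorelJacquet1979, §4.1] -/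
theorem νinf_apply_eq_measure_setOf
    (νN : Measure ↥(unipDelta L e dV hdV dW hdW))
    (νv : ∀ v : HeightOneSpectrum (𝓞 (Fp L)), Measure ↥(unipDeltaLoc L e dV hdV dW hdW v)) (hνσ : ∀ v, SigmaFinite (νv v))
    (hνK : ∀ v, νv v (((inH (fun v => UnitaryGroup.localInt L (IsCMField.complexConj L) (n + n) (hermD L e dV hdV dW hdW) v)
      (fun v => unipDeltaLoc L e dV hdV dW hdW v) v) : Subgroup ↥(unipDeltaLoc L e dV hdV dW hdW v)) : Set ↥(unipDeltaLoc L e dV hdV dW hdW v)) = 1)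
    (T : Finset (HeightOneSpectrum (𝓞 (Fp L)))) (νinfT : Measure ↥(unipDeltaArch L e dV hdV dW hdW))
    (hmap : Measure.map (unipDeltaSplitAt L e dV hdV dW hdW T) νN =
      νinfT.prod ((Measure.pi fun v : T => νv v.1).prod
        (rpMeasure (fun v : {v : HeightOneSpectrum (𝓞 (Fp L)) // v ∉ T} => ((inH (fun v => UnitaryGroup.localInt L (IsCMField.complexConj L) (n + n) (hermD L e dV hdV dW hdW) v) (fun v => unipDeltaLoc L e dV hdV dW hdW v) v.1 : Subgroup ↥(unipDeltaLoc L e dV hdV dW hdW v.1)) : Set ↥(unipDeltaLoc L e dV hdV dW hdW v.1))) (fun v => νv v.1) ∅)))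
    {A : Set ↥(unipDeltaArch L e dV hdV dW hdW)} (hA : MeasurableSet A) :
    νinfT A = νN {u : ↥(unipDelta L e dV hdV dW hdW) | (unipDeltaSplit L e dV hdV dW hdW u).1 ∈ A ∧
      ∀ v : HeightOneSpectrum (𝓞 (Fp L)), (unipDeltaSplit L e dV hdV dW hdW u).2 v ∈ (inH (fun v => UnitaryGroup.localInt L (IsCMField.complexConj L) (n + n) (hermD L e dV hdV dW hdW) v) (fun v => unipDeltaLoc L e dV hdV dW hdW v) v : Subgroup ↥(unipDeltaLoc L e dV hdV dW hdW v))} := by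
  -- the Borel tower of ★ Φ3b §3 (measurability of the continuous splitting `unipDeltaSplitAt T`)
  haveI : Countable (HeightOneSpectrum (𝓞 (Fp L))) := countable_heightOneSpectrum (Fp L)
  haveI : ∀ v, SecondCountableTopology ↥(unipDeltaLoc L e dV hdV dW hdW v) := fun v => secondCountableTopology_unipDeltaLoc L e dV hdV dW hdW v
  haveI := fact_isOpen_inH_unipDeltaLoc L e dV hdV dW hdW
  haveI := fact_isOpen_off (fun v => ↥(unipDeltaLoc L e dV hdV dW hdW v)) (fun v => inH (fun v => UnitaryGroup.localInt L (IsCMField.complexConj L) (n + n) (hermD L e dV hdV dW hdW) v) (fun v => unipDeltaLoc L e dV hdV dW hdW v) v) T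
  haveI := borelSpace_off (fun v => ↥(unipDeltaLoc L e dV hdV dW hdW v)) (fun v => inH (fun v => UnitaryGroup.localInt L (IsCMField.complexConj L) (n + n) (hermD L e dV hdV dW hdW) v) (fun v => unipDeltaLoc L e dV hdV dW hdW v) v) T
  haveI := secondCountableTopology_off (fun v => ↥(unipDeltaLoc L e dV hdV dW hdW v)) (fun v => inH (fun v => UnitaryGroup.localInt L (IsCMField.complexConj L) (n + n) (hermD L e dV hdV dW hdW) v) (fun v => unipDeltaLoc L e dV hdV dW hdW v) v) T
  haveI := secondCountableTopology_unipDeltaArch L e dV hdV dW hdW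
  haveI hT2 : SecondCountableTopology (Π v : T, ↥(unipDeltaLoc L e dV hdV dW hdW v.1)) := inferInstance
  haveI : SecondCountableTopologyEither (Π v : T, ↥(unipDeltaLoc L e dV hdV dW hdW v.1)) (Πʳ v : {v : HeightOneSpectrum (𝓞 (Fp L)) // v ∉ T}, [↥(unipDeltaLoc L e dV hdV dW hdW v.1), inH (fun v => UnitaryGroup.localInt L (IsCMField.complexConj L) (n + n) (hermD L e dV hdV dW hdW) v) (fun v => unipDeltaLoc L e dV hdV dW hdW v) v.1]) := secondCountableTopologyEither_of_left _ _
  haveI hB2 : BorelSpace ((Π v : T, ↥(unipDeltaLoc L e dV hdV dW hdW v.1)) × (Πʳ v : {v : HeightOneSpectrum (𝓞 (Fp L)) // v ∉ T}, [↥(unipDeltaLoc L e dV hdV dW hdW v.1), inH (fun v => UnitaryGroup.localInt L (IsCMField.complexConj L) (n + n) (hermD L e dV hdV dW hdW) v) (fun v => unipDeltaLoc L e dV hdV dW hdW v) v.1])) := Prod.borelSpace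
  haveI : SecondCountableTopologyEither ↥(unipDeltaArch L e dV hdV dW hdW) ((Π v : T, ↥(unipDeltaLoc L e dV hdV dW hdW v.1)) × (Πʳ v : {v : HeightOneSpectrum (𝓞 (Fp L)) // v ∉ T}, [↥(unipDeltaLoc L e dV hdV dW hdW v.1), inH (fun v => UnitaryGroup.localInt L (IsCMField.complexConj L) (n + n) (hermD L e dV hdV dW hdW) v) (fun v => unipDeltaLoc L e dV hdV dW hdW v) v.1])) := secondCountableTopologyEither_of_left _ _
  haveI : BorelSpace (↥(unipDeltaArch L e dV hdV dW hdW) × ((Π v : T, ↥(unipDeltaLoc L e dV hdV dW hdW v.1)) × (Πʳ v : {v : HeightOneSpectrum (𝓞 (Fp L)) // v ∉ T}, [↥(unipDeltaLoc L e dV hdV dW hdW v.1), inH (fun v => UnitaryGroup.localInt L (IsCMField.complexConj L) (n + n) (hermD L e dV hdV dW hdW) v) (fun v => unipDeltaLoc L e dV hdV dW hdW v) v.1]))) := Prod.borelSpace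
  haveI : ∀ v, SigmaFinite (νv v) := hνσ
  -- the compact-open subgroups `K_v`: measurable, nonempty, of mass one
  have hKm : ∀ v : HeightOneSpectrum (𝓞 (Fp L)), MeasurableSet ((inH (fun v => UnitaryGroup.localInt L (IsCMField.complexConj L) (n + n) (hermD L e dV hdV dW hdW) v) (fun v => unipDeltaLoc L e dV hdV dW hdW v) v : Subgroup ↥(unipDeltaLoc L e dV hdV dW hdW v)) : Set ↥(unipDeltaLoc L e dV hdV dW hdW v)) :=
    fun v => (isOpen_inH_unipDeltaLoc L e dV hdV dW hdW v).measurableSet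
  have hCm : ∀ v : {v : HeightOneSpectrum (𝓞 (Fp L)) // v ∉ T}, MeasurableSet ((inH (fun v => UnitaryGroup.localInt L (IsCMField.complexConj L) (n + n) (hermD L e dV hdV dW hdW) v) (fun v => unipDeltaLoc L e dV hdV dW hdW v) v.1 : Subgroup ↥(unipDeltaLoc L e dV hdV dW hdW v.1)) : Set ↥(unipDeltaLoc L e dV hdV dW hdW v.1)) :=
    fun v => hKm v.1
  have hCne : ∀ v : {v : HeightOneSpectrum (𝓞 (Fp L)) // v ∉ T}, ((inH (fun v => UnitaryGroup.localInt L (IsCMField.complexConj L) (n + n) (hermD L e dV hdV dW hdW) v) (fun v => unipDeltaLoc L e dV hdV dW hdW v) v.1 : Subgroup ↥(unipDeltaLoc L e dV hdV dW hdW v.1)) : Set ↥(unipDeltaLoc L e dV hdV dW hdW v.1)).Nonempty :=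
    fun v => ⟨1, Subgroup.one_mem _⟩
  have hm1 : ∀ v : {v : HeightOneSpectrum (𝓞 (Fp L)) // v ∉ T}, v ∉ (∅ : Finset {v : HeightOneSpectrum (𝓞 (Fp L)) // v ∉ T}) → νv v.1 ((inH (fun v => UnitaryGroup.localInt L (IsCMField.complexConj L) (n + n) (hermD L e dV hdV dW hdW) v) (fun v => unipDeltaLoc L e dV hdV dW hdW v) v.1 : Subgroup ↥(unipDeltaLoc L e dV hdV dW hdW v.1)) : Set ↥(unipDeltaLoc L e dV hdV dW hdW v.1)) = 1 :=
    fun v _ => hνK v.1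
  haveI : SigmaFinite (rpMeasure (fun v : {v : HeightOneSpectrum (𝓞 (Fp L)) // v ∉ T} => ((inH (fun v => UnitaryGroup.localInt L (IsCMField.complexConj L) (n + n) (hermD L e dV hdV dW hdW) v) (fun v => unipDeltaLoc L e dV hdV dW hdW v) v.1 : Subgroup ↥(unipDeltaLoc L e dV hdV dW hdW v.1)) : Set ↥(unipDeltaLoc L e dV hdV dW hdW v.1))) (fun v => νv v.1) ∅) :=
    sigmaFinite_rpMeasure _ _ hCm (S₀ := ∅) hm1
  -- the finite factors of the box have mass one
  have hpi : (Measure.pi fun v : T => νv v.1) (Set.univ.pi fun v : T => ((inH (fun v => UnitaryGroup.localInt L (IsCMField.complexConj L) (n + n) (hermD L e dV hdV dW hdW) v) (fun v => unipDeltaLoc L e dV hdV dW hdW v) v.1 : Subgroup ↥(unipDeltaLoc L e dV hdV dW hdW v.1)) : Set ↥(unipDeltaLoc L e dV hdV dW hdW v.1))) = 1 := by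
    rw [Measure.pi_pi]
    exact Finset.prod_eq_one fun v _ => hνK v.1
  have hrp : (rpMeasure (fun v : {v : HeightOneSpectrum (𝓞 (Fp L)) // v ∉ T} => ((inH (fun v => UnitaryGroup.localInt L (IsCMField.complexConj L) (n + n) (hermD L e dV hdV dW hdW) v) (fun v => unipDeltaLoc L e dV hdV dW hdW v) v.1 : Subgroup ↥(unipDeltaLoc L e dV hdV dW hdW v.1)) : Set ↥(unipDeltaLoc L e dV hdV dW hdW v.1))) (fun v => νv v.1) ∅)
      {y : Πʳ v : {v : HeightOneSpectrum (𝓞 (Fp L)) // v ∉ T}, [↥(unipDeltaLoc L e dV hdV dW hdW v.1), inH (fun v => UnitaryGroup.localInt L (IsCMField.complexConj L) (n + n) (hermD L e dV hdV dW hdW) v) (fun v => unipDeltaLoc L e dV hdV dW hdW v) v.1] | ∀ j : {v : HeightOneSpectrum (𝓞 (Fp L)) // v ∉ T}, y j ∈ ((inH (fun v => UnitaryGroup.localInt L (IsCMField.complexConj L) (n + n) (hermD L e dV hdV dW hdW) v) (fun v => unipDeltaLoc L e dV hdV dW hdW v) j.1 : Subgroup ↥(unipDeltaLoc L e dV hdV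 dW hdW j.1)) : Set ↥(unipDeltaLoc L e dV hdV dW hdW j.1))} = 1 := by
    have h := rpMeasure_setOf_forall_mem_eq_prod (fun v : {v : HeightOneSpectrum (𝓞 (Fp L)) // v ∉ T} => ((inH (fun v => UnitaryGroup.localInt L (IsCMField.complexConj L) (n + n) (hermD L e dV hdV dW hdW) v) (fun v => unipDeltaLoc L e dV hdV dW hdW v) v.1 : Subgroup ↥(unipDeltaLoc L e dV hdV dW hdW v.1)) : Set ↥(unipDeltaLoc L e dV hdV dW hdW v.1))) (fun v => νv v.1)
      hCne hCm (S₀ := ∅) hm1 (S := ∅) (Finset.Subset.refl _) hCm (fun _ _ => rfl)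
    rw [Finset.prod_empty] at h
    exact h
  -- measurability of the splitting and of the box
  have hmeas : Measurable (unipDeltaSplitAt L e dV hdV dW hdW T) := (unipDeltaSplitAt L e dV hdV dW hdW T).continuous.measurable
  have hbox : MeasurableSet (A ×ˢ ((Set.univ.pi fun v : T => ((inH (fun v => UnitaryGroup.localInt L (IsCMField.complexConj L) (n + n) (hermD L e dV hdV dW hdW) v) (fun v => unipDeltaLoc L e dV hdV dW hdW v) v.1 : Subgroup ↥(unipDeltaLoc L e dV hdV dW hdW v.1)) : Set ↥(unipDeltaLoc L e dV hdV dW hdW v.1))) ×ˢ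
      {y : Πʳ v : {v : HeightOneSpectrum (𝓞 (Fp L)) // v ∉ T}, [↥(unipDeltaLoc L e dV hdV dW hdW v.1), inH (fun v => UnitaryGroup.localInt L (IsCMField.complexConj L) (n + n) (hermD L e dV hdV dW hdW) v) (fun v => unipDeltaLoc L e dV hdV dW hdW v) v.1] | ∀ j : {v : HeightOneSpectrum (𝓞 (Fp L)) // v ∉ T}, y j ∈ ((inH (fun v => UnitaryGroup.localInt L (IsCMField.complexConj L) (n + n) (hermD L e dV hdV dW hdW) v) (fun v => unipDeltaLoc L e dV hdV dW hdW v) j.1 : Subgroup ↥(unipDeltaLoc L e dV hdV dW hdW j.1)) : Set ↥(unipDeltaLoc L e dV hdV dW hdW j.1))})) :=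
    hA.prod ((MeasurableSet.univ_pi fun v => hKm v.1).prod
      (measurableSet_setOf_forall_mem (fun v : {v : HeightOneSpectrum (𝓞 (Fp L)) // v ∉ T} => ((inH (fun v => UnitaryGroup.localInt L (IsCMField.complexConj L) (n + n) (hermD L e dV hdV dW hdW) v) (fun v => unipDeltaLoc L e dV hdV dW hdW v) v.1 : Subgroup ↥(unipDeltaLoc L e dV hdV dW hdW v.1)) : Set ↥(unipDeltaLoc L e dV hdV dW hdW v.1))) hCm hCm))
  -- evaluate `hmap` on the box
  calc νinfT A
      = νinfT A * ((Measure.pi fun v : T => νv v.1) (Set.univ.pi fun v : T => ((inH (fun v => UnitaryGroup.localInt L (IsCMField.complexConj L) (n + n) (hermD L e dV hdV dW hdW) v) (fun v => unipDeltaLoc L e dV hdV dW hdW v) v.1 : Subgroup ↥(unipDeltaLoc L e dV hdV dW hdW v.1)) : Set ↥(unipDeltaLoc L e dV hdV dW hdW v.1))) *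
          (rpMeasure (fun v : {v : HeightOneSpectrum (𝓞 (Fp L)) // v ∉ T} => ((inH (fun v => UnitaryGroup.localInt L (IsCMField.complexConj L) (n + n) (hermD L e dV hdV dW hdW) v) (fun v => unipDeltaLoc L e dV hdV dW hdW v) v.1 : Subgroup ↥(unipDeltaLoc L e dV hdV dW hdW v.1)) : Set ↥(unipDeltaLoc L e dV hdV dW hdW v.1))) (fun v => νv v.1) ∅)
            {y : Πʳ v : {v : HeightOneSpectrum (𝓞 (Fp L)) // v ∉ T}, [↥(unipDeltaLoc L e dV hdV dW hdW v.1), inH (fun v => UnitaryGroup.localInt L (IsCMField.complexConj L) (n + n) (hermD L e dV hdV dW hdW) v) (fun v => unipDeltaLoc L e dV hdV dW hdW v) v.1] | ∀ j : {v : HeightOneSpectrum (𝓞 (Fp L)) // v ∉ T}, y j ∈ ((inH (fun v => UnitaryGroup.localInt L (IsCMField.complexConj L) (n + n) (hermD L e dV hdV dW hdW) v) (fun v => unipDeltaLoc L e dV hdV dW hdW v) j.1 : Subgroup ↥(unipDeltaLoc L e dV hdV dW hdW j.1)) : Set ↥(unipDeltaLoc L e dV hdV dW hdW j.1))}) :=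 by
        rw [hpi, hrp, mul_one, mul_one]
    _ = (νinfT.prod ((Measure.pi fun v : T => νv v.1).prod
          (rpMeasure (fun v : {v : HeightOneSpectrum (𝓞 (Fp L)) // v ∉ T} => ((inH (fun v => UnitaryGroup.localInt L (IsCMField.complexConj L) (n + n) (hermD L e dV hdV dW hdW) v) (fun v => unipDeltaLoc L e dV hdV dW hdW v) v.1 : Subgroup ↥(unipDeltaLoc L e dV hdV dW hdW v.1)) : Set ↥(unipDeltaLoc L e dV hdV dW hdW v.1))) (fun v => νv v.1) ∅)))
          (A ×ˢ ((Set.univ.pi fun v : T => ((inH (fun v => UnitaryGroup.localInt L (IsCMField.complexConj L) (n + n) (hermD L e dV hdV dW hdW) v) (fun v => unipDeltaLoc L e dV hdV dW hdW v) v.1 : Subgroup ↥(unipDeltaLoc L e dV hdV dW hdW v.1)) : Set ↥(unipDeltaLoc L e dV hdV dW hdW v.1))) ×ˢ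
      {y : Πʳ v : {v : HeightOneSpectrum (𝓞 (Fp L)) // v ∉ T}, [↥(unipDeltaLoc L e dV hdV dW hdW v.1), inH (fun v => UnitaryGroup.localInt L (IsCMField.complexConj L) (n + n) (hermD L e dV hdV dW hdW) v) (fun v => unipDeltaLoc L e dV hdV dW hdW v) v.1] | ∀ j : {v : HeightOneSpectrum (𝓞 (Fp L)) // v ∉ T}, y j ∈ ((inH (fun v => UnitaryGroup.localInt L (IsCMField.complexConj L) (n + n) (hermD L e dV hdV dW hdW) v) (fun v => unipDeltaLoc L e dV hdV dW hdW v) j.1 : Subgroup ↥(unipDeltaLoc L e dV hdV dW hdW j.1)) : Set ↥(unipDeltaLoc L e dV hdV dW hdW j.1))})) := by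
        rw [Measure.prod_prod, Measure.prod_prod]
    _ = νN ((unipDeltaSplitAt L e dV hdV dW hdW T) ⁻¹' (A ×ˢ ((Set.univ.pi fun v : T => ((inH (fun v => UnitaryGroup.localInt L (IsCMField.complexConj L) (n + n) (hermD L e dV hdV dW hdW) v) (fun v => unipDeltaLoc L e dV hdV dW hdW v) v.1 : Subgroup ↥(unipDeltaLoc L e dV hdV dW hdW v.1)) : Set ↥(unipDeltaLoc L e dV hdV dW hdW v.1))) ×ˢ
      {y : Πʳ v : {v : HeightOneSpectrum (𝓞 (Fp L)) // v ∉ T}, [↥(unipDeltaLoc L e dV hdV dW hdW v.1), inH (fun v => UnitaryGroup.localInt L (IsCMField.complexConj L) (n + n) (hermD L e dV hdV dW hdW) v) (fun v => unipDeltaLoc L e dV hdV dW hdW v) v.1] | ∀ j : {v : HeightOneSpectrum (𝓞 (Fp L)) // v ∉ T}, y j ∈ ((inH (fun v => UnitaryGroup.localInt L (IsCMField.complexConj L) (n + n) (hermD L e dV hdV dW hdW) v) (fun v => unipDeltaLoc L e dV hdV dW hdW v) j.1 : Subgroup ↥(unipDeltaLoc L e dV hdV dW hdW j.1)) : Set ↥(unipDeltaLoc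 L e dV hdV dW hdW j.1))}))) :=
        (DFunLike.congr_fun hmap _).symm.trans (Measure.map_apply hmeas hbox)
    _ = νN {u : ↥(unipDelta L e dV hdV dW hdW) | (unipDeltaSplit L e dV hdV dW hdW u).1 ∈ A ∧
      ∀ v : HeightOneSpectrum (𝓞 (Fp L)), (unipDeltaSplit L e dV hdV dW hdW u).2 v ∈ (inH (fun v => UnitaryGroup.localInt L (IsCMField.complexConj L) (n + n) (hermD L e dV hdV dW hdW) v) (fun v => unipDeltaLoc L e dV hdV dW hdW v) v : Subgroup ↥(unipDeltaLoc L e dV hdV dW hdW v))} := by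
        rw [preimage_unipDeltaSplitAt_box]

/-! ## §3 The head: the archimedean carrier is uniform in `T` -/

/-- **THE ARCHIMEDEAN CARRIER OF THE PINNED SPLITTING IS UNIFORM IN `T`.**  In the currency of ★ `kindW_block_cm_of_localLetters_haar` (p863724): if
local measures `ν_v` (σ-finite, clause `hνσ`) give mass one to `K_{H,v} ∩ N_Δ(L⁺_v)` at every finite place (clause `hνK`, :84–85) and the family
`νinf T` factorises `νN` along `unipDeltaSplitAt T` for every `T` (clause `hmap`, :86–89), then `νinf T = νinf T'` for all `T, T'` — both equal
`A ↦ νN {u | u_∞ ∈ A ∧ ∀ v, u_v ∈ K_{H,v} ∩ N_Δ(L⁺_v)}` on measurable sets (§2), `Measure.ext`.  No Haar uniqueness is used; `νN` and the `νinf T` need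
not be Haar measures. [cite: CasselsFrohlichANT1967, Ch. XV (Tate) §3.3] [cite: BorelJacquet1979, §4.1] [cite: Tan1999, §2] -/
theorem νinf_eq_of_factorisation
    (νN : Measure ↥(unipDelta L e dV hdV dW hdW))
    (νv : ∀ v : HeightOneSpectrum (𝓞 (Fp L)), Measure ↥(unipDeltaLoc L e dV hdV dW hdW v)) (hνσ : ∀ v, SigmaFinite (νv v))
    (hνK : ∀ v, νv v (((inH (fun v => UnitaryGroup.localInt L (IsCMField.complexConj L) (n + n) (hermD L e dV hdV dW hdW) v)
      (fun v => unipDeltaLoc L e dV hdV dW hdW v) v) : Subgroup ↥(unipDeltaLoc L e dV hdV dW hdW v)) : Set ↥(unipDeltaLoc L e dV hdV dW hdW v)) = 1)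
    (νinf : Finset (HeightOneSpectrum (𝓞 (Fp L))) → Measure ↥(unipDeltaArch L e dV hdV dW hdW))
    (hmap : ∀ T : Finset (HeightOneSpectrum (𝓞 (Fp L))), Measure.map (unipDeltaSplitAt L e dV hdV dW hdW T) νN =
      (νinf T).prod ((Measure.pi fun v : T => νv v.1).prod
        (rpMeasure (fun v : {v : HeightOneSpectrum (𝓞 (Fp L)) // v ∉ T} => ((inH (fun v => UnitaryGroup.localInt L (IsCMField.complexConj L) (n + n) (hermD L e dV hdV dW hdW) v) (fun v => unipDeltaLoc L e dV hdV dW hdW v) v.1 : Subgroup ↥(unipDeltaLoc L e dV hdV dW hdW v.1)) : Set ↥(unipDeltaLoc L e dV hdV dW hdW v.1))) (fun v => νv v.1) ∅))) :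
    ∀ T T' : Finset (HeightOneSpectrum (𝓞 (Fp L))), νinf T = νinf T' := fun T T' =>
  Measure.ext fun A hA => by
    rw [νinf_apply_eq_measure_setOf L e dV hdV dW hdW νN νv hνσ hνK T (νinf T) (hmap T) hA,
      νinf_apply_eq_measure_setOf L e dV hdV dW hdW νN νv hνσ hνK T' (νinf T') (hmap T') hA]

end Measures

end Summit.HodgeConjecture.HodgeConjecture.Cruxes.HLiu418.K2LiuKindWArchCarrierUniform

end
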